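import Mathlib
import Summits.Ventures.PercRepro2.HCov
import Summits.Ventures.PercRepro2.PocketTransport
import Summits.Ventures.PercRepro2.RootLeafUPocketGraph
import Summits.Ventures.PercRepro2.RootLeafUPocketShare
import Summits.Ventures.PercRepro2.RootLeafUPocketFacts


/-!
# Adding one edge outside a pocket: the augmented instance on `Option E`
(blind cell PercRepro2, p4 g22; S3 (G4-u), the «limit» route of proofs/P4-G19-OUTSIDE.md §2 for `(P-33)` / `(P-24)`; no definitions)

For a pocket `P ∋ b` with terminals `u, a₂, c` in the instance `(E, ends, p)`, the **augmented instance** lives on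
`Option E`: the new edge `none` joins `u` and `c` with weight `r` (`fun o => o.elim s(u, c) ends`,
`fun o => o.elim r (zeroOn (touches ends P)ᶜ p)` — the old outside zeroed).  Then
* `prob_option_some` / `prob_option_none`: the two marginals of the product measure on `Option E`;
* `conn_option_of_none_false`: with the new edge closed, connections are the old ones;
  `conn_single_edge`: in the configuration whose only open edge is the new one, `x ↔ y` iff `x = y` or
  `{x, y} = {u, c}`;
* `touches_option`, `hP_option`: the new edge does not touch the pocket, and the pocket property survives;
* `prob_inn_option`: the pocket atoms of the augmented instance are those of the original instance;
* `prob_off_option_atom`, `prob_off_option_PD`, `prob_off_option_T`: the outside atoms of the augmented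
  instance (three pairwise distinct terminals) are `r` on the pattern `u ~ c`, `1 − r` on the trivial pattern,
  `0` elsewhere; `D₀ = 1 − r`, `t₀ = 0`.
So the o-free core `(OU) = D₀·E⁰ + t₀·E¹` (RootLeafUPocket3L) of the augmented instance is
`(1 − r)·E⁰(x = (0, 0, 0, r, 1 − r), w)` with the ORIGINAL pocket law `w` — a family of inequalities in `r`
whose endpoint `r → 1` is the pocket coefficient `C₃₃` (RootLeafUPocket3C33).
-/

namespace Summit.Ventures.PercRepro2

namespace RootLeafU

namespace PocketAddEdge

variable {E : Type*} [Fintype E] {R : Type*} [CommRing R]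

/-- The Bernoulli weight on `Option E` factorises into the factor of `none` and the weight on `E`. -/
lemma weight_option (p' : Option E → R) (ω' : Config (Option E)) :
    weight p' ω' = edgeFactor (p' none) (ω' none) * weight (fun e => p' (some e)) (fun e => ω' (some e)) := by
  unfold weight
  rw [Fintype.prod_option]

/-- The weight of the configuration assembled from the value of `none` and a configuration on `E`. -/
lemma weight_option_symm (p' : Option E → R) (b : Bool) (ω : Config E) :
    weight p' ((Equiv.piOptionEquivProd (β := fun _ : Option E => Bool)).symm (b, ω)) =
      edgeFactor (p' none) b * weight (fun e => p' (some e)) ω := by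
  rw [weight_option]
  rfl

variable [DecidableEq E]

/-- The marginal on the old edges: the event `{ω' | ω' ∘ some ∈ A}` has the `E`-probability of `A`. -/
theorem prob_option_some (p' : Option E → R) (A : Set (Config E)) :
    prob p' {ω' : Config (Option E) | (fun e => ω' (some e)) ∈ A} = prob (fun e => p' (some e)) A := by
  classical
  unfold prob
  rw [← (Equiv.piOptionEquivProd (β := fun _ : Option E => Bool)).symm.sum_comp, Fintype.sum_prod_type,
    Fintype.sum_bool, ← Finset.sum_add_distrib]
  refine Finset.sum_congr rfl fun ω _ => ?_
  have hmem : ∀ b : Bool, (Equiv.piOptionEquivProd (β := fun _ : Option E => Bool)).symm (b, ω) ∈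
      {ω' : Config (Option E) | (fun e => ω' (some e)) ∈ A} ↔ ω ∈ A := fun b => Iff.rfl
  by_cases hA : ω ∈ A
  · rw [Set.indicator_of_mem hA, Set.indicator_of_mem ((hmem true).2 hA),
      Set.indicator_of_mem ((hmem false).2 hA), weight_option_symm, weight_option_symm]
    simp only [edgeFactor_true, edgeFactor_false]
    ring
  · rw [Set.indicator_of_notMem hA, Set.indicator_of_notMem (fun h => hA ((hmem true).1 h)),
      Set.indicator_of_notMem (fun h => hA ((hmem false).1 h))]
    ring

/-- The marginal of the new edge: `P(ω' none = b) = edgeFactor (p' none) b`. -/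
theorem prob_option_none (p' : Option E → R) (b : Bool) :
    prob p' {ω' : Config (Option E) | ω' none = b} = edgeFactor (p' none) b := by
  classical
  unfold prob
  rw [← (Equiv.piOptionEquivProd (β := fun _ : Option E => Bool)).symm.sum_comp, Fintype.sum_prod_type,
    Fintype.sum_bool]
  have hmem : ∀ (b' : Bool) (ω : Config E), (Equiv.piOptionEquivProd (β := fun _ : Option E => Bool)).symm (b', ω) ∈
      {ω' : Config (Option E) | ω' none = b} ↔ b' = b := fun b' ω => Iff.rfl
  have hsum := sum_weight (fun e => p' (some e))
  cases b
  · have h1 : ∀ ω : Config E, (Equiv.piOptionEquivProd (β := fun _ : Option E => Bool)).symm (true, ω) ∉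
        {ω' : Config (Option E) | ω' none = false} := fun ω h => Bool.true_eq_false.mp ((hmem true ω).1 h) |>.elim
    have h2 : ∀ ω : Config E, (Equiv.piOptionEquivProd (β := fun _ : Option E => Bool)).symm (false, ω) ∈
        {ω' : Config (Option E) | ω' none = false} := fun ω => (hmem false ω).2 rfl
    simp only [Set.indicator_of_notMem (h1 _), Set.indicator_of_mem (h2 _), weight_option_symm,
      Finset.sum_const_zero, zero_add, ← Finset.mul_sum, hsum, mul_one]
  · have h1 : ∀ ω : Config E, (Equiv.piOptionEquivProd (β := fun _ : Option E => Bool)).symm (true, ω) ∈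
        {ω' : Config (Option E) | ω' none = true} := fun ω => (hmem true ω).2 rfl
    have h2 : ∀ ω : Config E, (Equiv.piOptionEquivProd (β := fun _ : Option E => Bool)).symm (false, ω) ∉
        {ω' : Config (Option E) | ω' none = true} := fun ω h => Bool.false_eq_true.mp ((hmem false ω).1 h) |>.elim
    simp only [Set.indicator_of_mem (h1 _), Set.indicator_of_notMem (h2 _), weight_option_symm,
      Finset.sum_const_zero, add_zero, ← Finset.mul_sum, hsum, mul_one]

end PocketAddEdge

end RootLeafU

end Summit.Ventures.PercRepro2



namespace Summit.Ventures.PercRepro2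

namespace RootLeafU

namespace PocketAddEdge

variable {V : Type*} {E : Type*}

/-- With the new edge closed, the open subgraph on `Option E` is the open subgraph on `E`. -/
lemma openGraph_option_of_none_false (ends : E → Sym2 V) (u c : V) (ω' : Config (Option E))
    (h0 : ω' none = false) :
    openGraph (fun o : Option E => o.elim s(u, c) ends) ω' = openGraph ends (fun e => ω' (some e)) := by
  ext x y
  rw [openGraph_adj, openGraph_adj]
  constructor
  · rintro ⟨hxy, e, he, hends⟩
    refine ⟨hxy, ?_⟩
    cases e with
    | none => exact absurd he (by rw [h0]; exact Bool.false_ne_true)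
    | some e => exact ⟨e, he, hends⟩
  · rintro ⟨hxy, e, he, hends⟩
    exact ⟨hxy, some e, he, hends⟩

/-- With the new edge closed, connections on `Option E` are connections on `E`. -/
lemma conn_option_of_none_false (ends : E → Sym2 V) (u c : V) (ω' : Config (Option E))
    (h0 : ω' none = false) (x y : V) :
    Conn (fun o : Option E => o.elim s(u, c) ends) ω' x y ↔ Conn ends (fun e => ω' (some e)) x y := by
  unfold Conn
  rw [openGraph_option_of_none_false ends u c ω' h0]

/-- The configuration on `Option E` whose only possibly open edge is the new one. -/
lemma conn_single_edge (ends : E → Sym2 V) (u c : V) (b : Bool) (x y : V) :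
    Conn (fun o : Option E => o.elim s(u, c) ends) (fun o => o.elim b (fun _ => false)) x y ↔
      x = y ∨ (b = true ∧ s(x, y) = s(u, c)) := by
  constructor
  · intro h
    -- closure: the set `{z | z = x ∨ (b = true ∧ s(x, z) = s(u, c))}` is closed under open adjacency
    have key := mem_of_conn_of_closed (ends := fun o : Option E => o.elim s(u, c) ends)
      (ω := fun o => o.elim b (fun _ => false)) (S := {z | z = x ∨ (b = true ∧ s(x, z) = s(u, c))})
      (fun z hz w hzw => by
        rw [openGraph_adj] at hzw
        obtain ⟨hne, e, he, hends⟩ := hzw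
        cases e with
        | some e => exact absurd he Bool.false_ne_true
        | none =>
          simp only [Option.elim] at he hends
          simp only [Set.mem_setOf_eq] at hz ⊢
          rcases hz with rfl | ⟨hb, hxz⟩
          · exact Or.inr ⟨he, hends.symm⟩
          · -- `s(x, z) = s(u, c) = s(z, w)` with `z ≠ w` forces `w = x`
            left
            rw [hends, Sym2.eq_iff] at hxz
            rcases hxz with ⟨h1, h2⟩ | ⟨h1, h2⟩
            · exact absurd h2 hne
            · exact h1.symm)
      (v := x) (u := y) (Or.inl rfl) h
    simp only [Set.mem_setOf_eq] at key
    rcases key with h1 | h1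
    · exact Or.inl h1.symm
    · exact Or.inr h1
  · rintro (rfl | ⟨hb, hxy⟩)
    · exact conn_refl _ _ _
    · exact conn_of_openAdj ⟨none, by simp [Option.elim, hb], by simpa [Option.elim] using hxy.symm⟩

end PocketAddEdge

end RootLeafU

end Summit.Ventures.PercRepro2



namespace Summit.Ventures.PercRepro2

open UnionCluster CovForm

namespace RootLeafU

namespace PocketAddEdge

variable {V : Type*} {E : Type*}

section Touches

variable {ends : E → Sym2 V} {P : Set V} {u c : V}

/-- The new edge `none` (ends `u, c ∉ P`) does not touch the pocket; the old edges touch it as before. -/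
lemma touches_option (hu : u ∉ P) (hc : c ∉ P) (o : Option E) :
    o ∈ touches (fun o : Option E => o.elim s(u, c) ends) P ↔ ∃ e, o = some e ∧ e ∈ touches ends P := by
  cases o with
  | none =>
    simp only [touches, Set.mem_setOf_eq, Option.elim, reduceCtorEq, false_and, exists_false, iff_false]
    rintro ⟨x, hx, y, hxy⟩
    rw [Sym2.eq_iff] at hxy
    rcases hxy with ⟨h1, _⟩ | ⟨_, h2⟩
    · exact hu (h1 ▸ hx)
    · exact hc (h2 ▸ hx)
  | some e =>
    simp only [touches, Set.mem_setOf_eq, Option.elim, Option.some.injEq, exists_eq_left']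

/-- The augmented incidence map still has the pocket property. -/
lemma hP_option {a₂ : V} (hP : ∀ e y z, ends e = s(y, z) → y ∈ P → z ∈ P ∨ z = u ∨ z = a₂ ∨ z = c)
    (hu : u ∉ P) (hc : c ∉ P) :
    ∀ e y z, (fun o : Option E => o.elim s(u, c) ends) e = s(y, z) → y ∈ P → z ∈ P ∨ z = u ∨ z = a₂ ∨ z = c := by
  intro e y z he hy
  cases e with
  | none =>
    simp only [Option.elim] at he
    rw [Sym2.eq_iff] at he
    rcases he with ⟨h1, _⟩ | ⟨_, h2⟩
    · exact absurd (h1 ▸ hy) hu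
    · exact absurd (h2 ▸ hy) hc
  | some e => exact hP e y z he hy

end Touches

section Transfer

variable [Fintype E] [DecidableEq E] [Fintype V] [DecidableEq V] {R : Type*} [Field R] [LinearOrder R] [IsStrictOrderedRing R]
variable {ends : E → Sym2 V} {P : Set V} {u a₂ c b : V} {inn : Config E → Config E}

omit [LinearOrder R] [IsStrictOrderedRing R] in
/-- **Pocket transfer**: the pocket part of the augmented instance (weights `r` on the new edge, the old
outside zeroed) has the pocket-atom probabilities of the original instance. -/
theorem prob_inn_option (p : E → R) (r : R) (hu : u ∉ P) (hc : c ∉ P)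
    (hinn : (∀ ω e, e ∈ touches ends P → inn ω e = ω e) ∧ (∀ ω e, e ∉ touches ends P → inn ω e = false))
    (inn' : Config (Option E) → Config (Option E))
    (hinn' : (∀ ω e, e ∈ touches (fun o : Option E => o.elim s(u, c) ends) P → inn' ω e = ω e) ∧
      (∀ ω e, e ∉ touches (fun o : Option E => o.elim s(u, c) ends) P → inn' ω e = false))
    (v : Bool × Bool × Bool × Bool × Bool × Bool) :
    prob (fun o : Option E => o.elim r (PocketConn.zeroOn (by classical exact (touches ends P)ᶜ.toFinset) p)) {ω' : Config (Option E) | inn' ω' ∈ {ω'' : Config (Option E) | (decide (Conn (fun o : Option E => o.elim s(u, c) ends) ω'' u a₂), decide (Conn (fun o : Option E => o.elim s(u, c) ends) ω'' u c), decide (Conn (fun o : Option E => o.elim s(u, c) ends) ω'' u b), decide (Conn (fun o : Option E => o.elim s(u, c) ends) ω'' a₂ c), decide (Conn (fun o : Option E => o.elim s(u, c) ends) ω'' a₂ b), decide (Conn (fun o : Option E => o.elim s(u, c) ends) ω'' c b)) = v}} =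
    prob p {ω : Config E | inn ω ∈ {ω'' : Config E | (decide (Conn ends ω'' u a₂), decide (Conn ends ω'' u c), decide (Conn ends ω'' u b), decide (Conn ends ω'' a₂ c), decide (Conn ends ω'' a₂ b), decide (Conn ends ω'' c b)) = v}} := by
  classical
  -- the pocket part of the augmented configuration is the old pocket part of `ω' ∘ some`, with `none` closed
  have h0 : ∀ ω' : Config (Option E), inn' ω' none = false := fun ω' =>
    hinn'.2 ω' none (by rw [touches_option hu hc]; rintro ⟨e, he, _⟩; cases he)
  have hsome : ∀ ω' : Config (Option E), (fun e => inn' ω' (some e)) = inn (fun e => ω' (some e)) := by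
    intro ω'
    funext e
    by_cases he : e ∈ touches ends P
    · rw [hinn'.1 ω' (some e) ((touches_option hu hc (some e)).2 ⟨e, rfl, he⟩), hinn.1 _ e he]
    · rw [hinn'.2 ω' (some e) (fun h => he (by obtain ⟨e', he', h'⟩ := (touches_option hu hc (some e)).1 h; cases he'; exact h')), hinn.2 _ e he]
  have hset : {ω' : Config (Option E) | inn' ω' ∈ {ω'' : Config (Option E) | (decide (Conn (fun o : Option E => o.elim s(u, c) ends) ω'' u a₂), decide (Conn (fun o : Option E => o.elim s(u, c) ends) ω'' u c), decide (Conn (fun o : Option E => o.elim s(u, c) ends) ω'' u b), decide (Conn (fun o : Option E => o.elim s(u, c) ends) ω'' a₂ c), decide (Conn (fun o : Option E => o.elim s(u, c) ends) ω'' a₂ b), decide (Conn (fun o : Option E => o.elim s(u, c) ends) ω'' c b)) = v}} =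
      {ω' : Config (Option E) | (fun e => ω' (some e)) ∈ {ω : Config E | inn ω ∈ {ω'' : Config E | (decide (Conn ends ω'' u a₂), decide (Conn ends ω'' u c), decide (Conn ends ω'' u b), decide (Conn ends ω'' a₂ c), decide (Conn ends ω'' a₂ b), decide (Conn ends ω'' c b)) = v}}} := by
    ext ω'
    simp only [Set.mem_setOf_eq]
    simp only [conn_option_of_none_false ends u c _ (h0 ω'), hsome ω']
  rw [hset, prob_option_some]
  -- the old pocket part under the zeroed outside weights is the old pocket part under `p`
  have hz : (fun e => (fun o : Option E => o.elim r (PocketConn.zeroOn (touches ends P)ᶜ.toFinset p)) (some e)) =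
      PocketConn.zeroOn (touches ends P)ᶜ.toFinset p := rfl
  rw [hz, PocketFacts.prob_inn_eq _ hinn, PocketFacts.prob_inn_eq _ hinn]
  congr 1
  funext e
  simp only [PocketConn.zeroOn]
  split_ifs <;> rfl

end Transfer

end PocketAddEdge

end RootLeafU

end Summit.Ventures.PercRepro2



namespace Summit.Ventures.PercRepro2

open UnionCluster CovForm

namespace RootLeafU

namespace PocketAddEdge

variable {V : Type*} {E : Type*}

section Outside

variable [Fintype E] [DecidableEq E] [Fintype V] [DecidableEq V] {R : Type*} [CommRing R]
variable {ends : E → Sym2 V} {P : Set V} {u a₂ c : V}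

/-- **Outside transfer**: with the old outside zeroed, the outside part of the augmented instance is the
single-edge configuration of the new edge. -/
theorem prob_off_option (p : E → R) (r : R) (hu : u ∉ P) (hc : c ∉ P)
    (off' : Config (Option E) → Config (Option E))
    (hoff' : (∀ ω e, e ∈ touches (fun o : Option E => o.elim s(u, c) ends) P → off' ω e = false) ∧
      (∀ ω e, e ∉ touches (fun o : Option E => o.elim s(u, c) ends) P → off' ω e = ω e))
    (Z : Set (Config (Option E))) :
    prob (fun o : Option E => o.elim r (PocketConn.zeroOn (by classical exact (touches ends P)ᶜ.toFinset) p)) {ω' : Config (Option E) | off' ω' ∈ Z} =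
    prob (fun o : Option E => o.elim r p) {ω' : Config (Option E) | (fun o : Option E => o.elim (ω' none) (fun _ => false)) ∈ Z} := by
  classical
  have hzero : (fun o : Option E => o.elim r (PocketConn.zeroOn (touches ends P)ᶜ.toFinset p)) =
      PocketConn.zeroOn (((touches ends P)ᶜ.toFinset).map Function.Embedding.some) (fun o : Option E => o.elim r p) := by
    funext o
    cases o with
    | none => simp [PocketConn.zeroOn, Option.elim]
    | some e =>
      simp only [PocketConn.zeroOn, Option.elim, Finset.mem_map, Function.Embedding.some_apply,
        Option.some.injEq, exists_eq_right]
  rw [hzero, PocketConn.prob_zeroOn]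
  congr 1
  ext ω'
  simp only [Set.mem_setOf_eq]
  have hclose : off' (PocketConn.closeOn (((touches ends P)ᶜ.toFinset).map Function.Embedding.some) ω') =
      (fun o : Option E => o.elim (ω' none) (fun _ => false)) := by
    funext o
    cases o with
    | none =>
      rw [hoff'.2 _ none (by rw [touches_option hu hc]; rintro ⟨e, he, _⟩; cases he)]
      simp [PocketConn.closeOn, Option.elim]
    | some e =>
      by_cases he : e ∈ touches ends P
      · rw [hoff'.1 _ (some e) ((touches_option hu hc (some e)).2 ⟨e, rfl, he⟩)]
        rfl
      · rw [hoff'.2 _ (some e) (fun h => he (by obtain ⟨e', he', h'⟩ := (touches_option hu hc (some e)).1 h; cases he'; exact h'))]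
        simp [PocketConn.closeOn, Option.elim, he]
  rw [hclose]

omit [DecidableEq E] in
/-- The pattern of the single-edge configuration on the three terminals (pairwise distinct). -/
lemma single_edge_pattern (hua : u ≠ a₂) (hac : a₂ ≠ c) (huc : u ≠ c) (b : Bool) :
    (decide (Conn (fun o : Option E => o.elim s(u, c) ends) (fun o : Option E => o.elim b (fun _ => false)) u a₂),
     decide (Conn (fun o : Option E => o.elim s(u, c) ends) (fun o : Option E => o.elim b (fun _ => false)) u c),
     decide (Conn (fun o : Option E => o.elim s(u, c) ends) (fun o : Option E => o.elim b (fun _ => false)) a₂ c)) = (false, b, false) := by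
  cases b <;> simp [conn_single_edge, hua, hac, huc, hua.symm, huc.symm]

/-- The outside atom of the augmented instance: `r` for the pattern `u ~ c`, `1 − r` for the trivial pattern, `0` otherwise. -/
theorem prob_off_option_atom (p : E → R) (r : R) (hu : u ∉ P) (hc : c ∉ P)
    (hua : u ≠ a₂) (hac : a₂ ≠ c) (huc : u ≠ c)
    (off' : Config (Option E) → Config (Option E))
    (hoff' : (∀ ω e, e ∈ touches (fun o : Option E => o.elim s(u, c) ends) P → off' ω e = false) ∧
      (∀ ω e, e ∉ touches (fun o : Option E => o.elim s(u, c) ends) P → off' ω e = ω e))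
    (v : Bool × Bool × Bool) :
    prob (fun o : Option E => o.elim r (PocketConn.zeroOn (by classical exact (touches ends P)ᶜ.toFinset) p)) {ω' : Config (Option E) | off' ω' ∈ {ω'' : Config (Option E) | (decide (Conn (fun o : Option E => o.elim s(u, c) ends) ω'' u a₂), decide (Conn (fun o : Option E => o.elim s(u, c) ends) ω'' u c), decide (Conn (fun o : Option E => o.elim s(u, c) ends) ω'' a₂ c)) = v}} =
    if v.1 = false ∧ v.2.2 = false then edgeFactor r v.2.1 else 0 := by
  classical
  rw [prob_off_option p r hu hc off' hoff']
  obtain ⟨v1, v2, v3⟩ := v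
  by_cases h : v1 = false ∧ v3 = false
  · obtain ⟨rfl, rfl⟩ := h
    have hset : {ω' : Config (Option E) | (fun o : Option E => o.elim (ω' none) (fun _ => false)) ∈ {ω'' : Config (Option E) | (decide (Conn (fun o : Option E => o.elim s(u, c) ends) ω'' u a₂), decide (Conn (fun o : Option E => o.elim s(u, c) ends) ω'' u c), decide (Conn (fun o : Option E => o.elim s(u, c) ends) ω'' a₂ c)) = (false, v2, false)}} = {ω' : Config (Option E) | ω' none = v2} := by
      ext ω'
      simp only [Set.mem_setOf_eq, single_edge_pattern hua hac huc]
      simp only [Prod.mk.injEq, true_and, and_true]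
    rw [hset, prob_option_none]
    simp only [Option.elim, and_self, if_true]
  · have hset : {ω' : Config (Option E) | (fun o : Option E => o.elim (ω' none) (fun _ => false)) ∈ {ω'' : Config (Option E) | (decide (Conn (fun o : Option E => o.elim s(u, c) ends) ω'' u a₂), decide (Conn (fun o : Option E => o.elim s(u, c) ends) ω'' u c), decide (Conn (fun o : Option E => o.elim s(u, c) ends) ω'' a₂ c)) = (v1, v2, v3)}} = ∅ := by
      ext ω'
      simp only [Set.mem_setOf_eq, single_edge_pattern hua hac huc]
      simp only [Prod.mk.injEq, Set.mem_empty_iff_false, iff_false]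
      rintro ⟨h1, _, h3⟩
      exact h ⟨h1.symm, h3.symm⟩
    rw [hset, prob_empty]
    simp only [h, if_false]

/-- `D₀` of the augmented instance: the new edge closed, `1 − r`. -/
theorem prob_off_option_PD (p : E → R) (r : R) (hu : u ∉ P) (hc : c ∉ P)
    (hua : u ≠ a₂) (hac : a₂ ≠ c) (huc : u ≠ c)
    (off' : Config (Option E) → Config (Option E))
    (hoff' : (∀ ω e, e ∈ touches (fun o : Option E => o.elim s(u, c) ends) P → off' ω e = false) ∧
      (∀ ω e, e ∉ touches (fun o : Option E => o.elim s(u, c) ends) P → off' ω e = ω e)) :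
    prob (fun o : Option E => o.elim r (PocketConn.zeroOn (by classical exact (touches ends P)ᶜ.toFinset) p)) {ω' : Config (Option E) | off' ω' ∈ PDEvent (fun o : Option E => o.elim s(u, c) ends) u a₂ c} = 1 - r := by
  classical
  rw [prob_off_option p r hu hc off' hoff']
  have hset : {ω' : Config (Option E) | (fun o : Option E => o.elim (ω' none) (fun _ => false)) ∈ PDEvent (fun o : Option E => o.elim s(u, c) ends) u a₂ c} = {ω' : Config (Option E) | ω' none = false} := by
    ext ω'
    simp only [Set.mem_setOf_eq, PDEvent, Dtilde, UnionCluster.inU, Set.mem_inter_iff, Set.mem_compl_iff, Set.mem_union, mem_connEvent]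
    cases hb : ω' none <;> simp [conn_single_edge, hua, hac, huc, hua.symm, hac.symm, huc.symm]
  rw [hset, prob_option_none]
  rfl

/-- `t₀` of the augmented instance: `a₂ ~ c` outside is impossible, `0`. -/
theorem prob_off_option_T (p : E → R) (r : R) (hu : u ∉ P) (hc : c ∉ P)
    (hua : u ≠ a₂) (hac : a₂ ≠ c) (huc : u ≠ c)
    (off' : Config (Option E) → Config (Option E))
    (hoff' : (∀ ω e, e ∈ touches (fun o : Option E => o.elim s(u, c) ends) P → off' ω e = false) ∧
      (∀ ω e, e ∉ touches (fun o : Option E => o.elim s(u, c) ends) P → off' ω e = ω e)) :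
    prob (fun o : Option E => o.elim r (PocketConn.zeroOn (by classical exact (touches ends P)ᶜ.toFinset) p)) {ω' : Config (Option E) | off' ω' ∈ TEvent (fun o : Option E => o.elim s(u, c) ends) u a₂ c} = 0 := by
  classical
  rw [prob_off_option p r hu hc off' hoff']
  have hset : {ω' : Config (Option E) | (fun o : Option E => o.elim (ω' none) (fun _ => false)) ∈ TEvent (fun o : Option E => o.elim s(u, c) ends) u a₂ c} = ∅ := by
    ext ω'
    simp only [Set.mem_setOf_eq, TEvent, Set.mem_inter_iff, Set.mem_compl_iff, mem_connEvent, Set.mem_empty_iff_false, iff_false]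
    cases hb : ω' none <;> simp [conn_single_edge, hac, huc, hua.symm, huc.symm]
  rw [hset, prob_empty]

end Outside

end PocketAddEdge

end RootLeafU

end Summit.Ventures.PercRepro2

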